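import Summits.BirchSwinnertonDyer.Rank1Residual.P2.CongruentNumberSilentEvenFiveThetaCMDescent
import Summits.BirchSwinnertonDyer.Rank1Residual.P2.CongruentNumberSilentEvenFiveThetaCMClassField
import Literature.NumberTheory.EllipticCurves.TianYuanZhang2017.CMPointClassFieldReduced
import HarnessLib

/-!
# Cell `bsd-monsky` (typer), route B: C-P2-1 on `𝒮⁻` from the REDUCED class-field display ALONE — the corner of record
# (`…_of_cmPointClassFieldData_descent (hCF)`, referee B ROUND 681) with three displayed sentences struck

HONEST FRAMING (cell `bsd-monsky`, run/shared/lean/pub/bsd-monsky/; README §1): ONE theorem on ONE explicit infinite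
family of quadratic twists of the congruent number curve at the prime `2`; not "BSD for rank ≤ 1", nothing at odd primes;
nothing is booked by this file. The corner of record of route B (referee B ROUND 681, 2026-08-27T10:21Z, unchanged since)
is `congruentSilentEvenFiveBSDTwo_of_cmPointClassFieldData_descent (hCF : tyz_cmPointClassFieldData)` — Theorem 1.1 on
`𝒮⁻` relative to ONE Literature display whose every conjunct is a printed sentence of [TianYuanZhang2017] §3 or of Cox's
Theorems 6.1 (ii) / 9.18, the `2`-Selmer input the tree's complete `2`-descent (p480559). A derivability audit of that
display (`Literature/…/TianYuanZhang2017/CMPointClassFieldReduced.lean`) found three displayed conjuncts that are kernel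
consequences of the others — Thm. 3.5's second bullet (from Prop. 3.4, Lemma 3.18, the `β′`-facts and Lemma 3.21, by the
source's own printed proof p0020 L106–p0021 L5), «`σ_{1+ϖ}` fixes `√−d`» (from Prop. 3.2 (2), (G4b) and Cox 6.1 (ii)) and,
for `d ≡ 6 (mod 8)`, «`σ ∈ Gal(H′_d/H_d)`» (from (G8) and (G4a)) — and proved them; `tyz_cmPointClassFieldDataReduced`
(`hCF′`) is `hCF` without those three conjuncts, and the two named facts are EQUIVALENT in the kernel
(`tyz_cmPointClassFieldData_iff_reduced`). This file is the corner on the reduced display: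
`congruentSilentEvenFiveBSDTwo_of_cmPointClassFieldDataReduced_descent (hCF′ : tyz_cmPointClassFieldDataReduced)`, with the
sharper form, clause (a) and the pair form from the same binder (proofs: one-line compositions of the corner of record /
its twins with `tyz_cmPointClassFieldData_of_reduced`). Marks of record untouched (route B: NONE). CONDITIONAL on the one
(reduced) display; nothing asserted; the conjecture `Prop`s stay `@[conjecture]`.
[cite: TianYuanZhang2017, §3.1 (J738–J739), Prop. 3.2 (1)(2)(3), Prop. 3.4, Thm. 3.5 (J741) and its proof (p0020 L106–L165, p0021 L1–L5), Thm. 3.6 (1)(2), Lemma 3.18, Lemma 3.21 and its proof (J759)]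
[cite: Cox2013, Theorem 6.1 (ii) and Theorem 9.18] [cite: SilvermanAEC2009, Prop. X.1.4, Prop. X.4.9, Thm. X.4.2]
[cite: Miller2011LMS, Def. 1.1 (arXiv:1010.2431 p. 3)]
-/

noncomputable section

open scoped Classical

open WeierstrassCurve Literature.NumberTheory.EllipticCurves
  Literature.NumberTheory.EllipticCurves.TianYuanZhang2017

set_option autoImplicit false

namespace Summit.BirchSwinnertonDyer.Rank1Residual.P2

open Conjectures

/-! ## §1 C-P2-1 on `𝒮⁻` from the reduced class-field display ALONE -/

/-- **C-P2-1 = Theorem 1.1 on `𝒮⁻` (`ord_{s=1} L(E_{2pq}, s) = 1 ∧ BSD(E_{2pq}, 2)`) from `tyz_cmPointClassFieldDataReduced`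
ALONE** — the corner of record (`…_of_cmPointClassFieldData_descent (hCF)`) with Thm. 3.5's second bullet, «`σ_{1+ϖ}` fixes
`√−d`» and «`σ ∈ Gal(H′_d/H_d)` for `d ≡ 6`» struck from the displayed hypothesis (they are kernel theorems of the other
displayed sentences); the `2`-Selmer input is the tree's complete `2`-descent. CONDITIONAL on the one reduced display;
nothing asserted. [cite: TianYuanZhang2017, §1 ((1.1)), Thm. 3.5 and its proof (p0020 L106–p0021 L5), Prop. 3.2, Thm. 3.6]
[cite: Cox2013, Theorem 6.1 (ii) and Theorem 9.18] [cite: SilvermanAEC2009, Prop. X.1.4, Prop. X.4.9, Thm. X.4.2]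
[cite: Miller2011LMS, Def. 1.1 (arXiv:1010.2431 p. 3)] -/
theorem congruentSilentEvenFiveBSDTwo_of_cmPointClassFieldDataReduced_descent
    (hCF : tyz_cmPointClassFieldDataReduced) : CongruentSilentEvenFiveBSDTwo :=
  congruentSilentEvenFiveBSDTwo_of_cmPointClassFieldData_descent (tyz_cmPointClassFieldData_of_reduced hCF)

/-! ## §2 The sharper form, clause (a) and the pair form from the reduced display ALONE -/

/-- **C-P2-1, sharper (`Ш_an`-unit) form, on `𝒮⁻` from `tyz_cmPointClassFieldDataReduced` ALONE.** CONDITIONAL; nothing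
asserted. [cite: TianYuanZhang2017, §1 ((1.1)), Thm. 3.5, Prop. 3.2, Thm. 3.6] [cite: Cox2013, Theorem 6.1 (ii) and Theorem 9.18]
[cite: SilvermanAEC2009, Prop. X.1.4, Prop. X.4.9] -/
theorem congruentSilentEvenFiveOrdTwo_of_cmPointClassFieldDataReduced_descent
    (hCF : tyz_cmPointClassFieldDataReduced) : CongruentSilentEvenFiveOrdTwo :=
  congruentSilentEvenFiveOrdTwo_of_cmPointClassFieldData_descent (tyz_cmPointClassFieldData_of_reduced hCF)

/-- **Clause (a) on all of `𝒮⁻` from the reduced display alone**: `ord_{s=1} L(E_{2pq}, s) = 1` (`g(2pq)` odd and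
Rédei–Reichardt are tree theorems; no Selmer input, no GZK binder — honest framing in `…ThetaDescentRank.lean`).
CONDITIONAL; nothing asserted. [cite: TianYuanZhang2017, Thm. 3.5, Prop. 3.2, Thm. 3.6, Lemma 3.21] [cite: Cox2013, Theorem 6.1 (ii) and Theorem 9.18] -/
theorem analyticRank_eq_one_sMinus_of_cmPointClassFieldDataReduced (hCF : tyz_cmPointClassFieldDataReduced)
    {p q : ℕ} (hp : p.Prime) (hq : q.Prime) (hp5 : p % 8 = 5) (hq4 : q % 4 = 3) (hj : jacobiSym p q = -1) :
    (congruentNumberCurve (2 * (p * q))).analyticRank = 1 :=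
  analyticRank_eq_one_sMinus_of_cmPointClassFieldData (tyz_cmPointClassFieldData_of_reduced hCF) hp hq hp5 hq4 hj

/-- **Both typed forms of C-P2-1 on `𝒮⁻` from `tyz_cmPointClassFieldDataReduced` ALONE.** CONDITIONAL; nothing asserted.
[cite: TianYuanZhang2017, Thm. 3.5, Prop. 3.2, Thm. 3.6] [cite: Cox2013, Theorem 6.1 (ii) and Theorem 9.18]
[cite: SilvermanAEC2009, Prop. X.1.4, Prop. X.4.9] -/
theorem congruentSilentEvenFive_pair_of_cmPointClassFieldDataReduced_descent
    (hCF : tyz_cmPointClassFieldDataReduced) : CongruentSilentEvenFiveOrdTwo ∧ CongruentSilentEvenFiveBSDTwo :=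
  ⟨congruentSilentEvenFiveOrdTwo_of_cmPointClassFieldDataReduced_descent hCF,
    congruentSilentEvenFiveBSDTwo_of_cmPointClassFieldDataReduced_descent hCF⟩

/-! ## §3 The two corners are interchangeable (the displayed facts are equivalent in the kernel) -/

/-- **The class-field corner and the reduced corner are the same theorem read through equivalent displays**: C-P2-1 follows
from `hCF` iff it follows from `hCF′`, because `hCF ⟺ hCF′` (`tyz_cmPointClassFieldData_iff_reduced`).
[cite: TianYuanZhang2017, §3] [cite: Cox2013, Theorem 6.1 (ii)] -/
theorem cmPointClassFieldData_imp_bsdTwo_iff_reduced_imp_bsdTwo :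
    (tyz_cmPointClassFieldData → CongruentSilentEvenFiveBSDTwo) ↔
      (tyz_cmPointClassFieldDataReduced → CongruentSilentEvenFiveBSDTwo) :=
  ⟨fun h hR => h (tyz_cmPointClassFieldData_of_reduced hR),
    fun h hC => h (tyz_cmPointClassFieldDataReduced_of_data hC)⟩

end Summit.BirchSwinnertonDyer.Rank1Residual.P2

end
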